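/- Copyright: the b2b-balaban cell (near-miss cell 7), T⁴-continuum fan-out; row NE7b ROUND-2 swarm, seat
t4-ne7b-formalise-leaf-06 (gen 6) (road W-RP, row W4 file 4b «THE TOWER-LAW READING»: the consumer junction of leaf-04's
W3m `HistoryRPTowerCuts` into this lineage's per-cutoff reading W4b′ `HistoryChessboardEventsCutoff`; INTENT journal
l.16399).  Released under the licence of the surrounding project. -/
import Summits.QuantumFields.BalabanUV.T4Continuum.Support.HistoryChessboardEventsSplit
import Summits.QuantumFields.BalabanUV.T4Continuum.Support.HistoryRPTowerCuts

/-!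
# Road W-RP, row W4 file 4b: THE TOWER-LAW READING — W4b′'s per-cutoff reading with its RP half PRODUCED

Summits-side support leaf of the T⁴-continuum cell (rung (B)+1 on a FINITE torus only; NOT infinite volume, NOT the
mass gap, NOT the Clay statement; NOT a proof of the spine estimate NE7b).  Row NE7b, road **W-RP** (owner's rulings
R-OWNER-23-2 ∕ R-OWNER-23-8: a LIVE SECONDARY road beside the COUNT road of record), row **W4**, file 4b — the CONSUMER
junction of sub-row W3m (`HistoryRPTowerCuts.cutoffRP_towerLaw(_gibbs_SU)`, leaf-04 g6: `prob` and the five RP clauses of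
W4b′'s `CutoffReading` for the TOWER LAW `(U, Ū, …, Ū^K)` at every block hyperplane `(i, k)` of the top lattice) into
file 3 of this lineage (`HistoryChessboardEventsCutoff`) through file 4a (`HistoryChessboardEventsSplit`: the event half
`EventSide`, the junction `EventSide.cutoffReading`, the block-count transport and `hybridNE7_of_cutoffReadingsN`).
[folklore] bookkeeping over TREE theorems; one DATA def (`cutoffParams`) and one `NeZero` instance; no `structure`, no
`[cite:]` tag (nothing printed is stated), no `Prop`-valued FACT minted (c1), no constant (c2∕c6), no exit ∕ socket ∕
`HistoryConstants` file touched (c3).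

WHAT.
* §1 THE FIXED-PHYSICAL-VOLUME CUTOFF FAMILY `cutoffParams P₀ K` (`d, L, m` of `P₀`; number of RG steps `K :=` the
  cutoff, `ε = L^{−K}`): `sitesPerDir_cutoffParams_self` — its unit lattice (level `K`) has `2·L^m` sites per direction at
  EVERY cutoff —, `even_sitesPerDir`, `even_two_mul_pow`: **(EVEN) IS A THEOREM** — W4's format hypothesis `Even N`
  (the road's wall item «`Even N` [T: the printed format of (0.1)]») holds for Bałaban's tori `2·L^j` (`Setup.sitesPerDir`)
  and is no longer a display for this family; `le_m_add_K_cutoffParams` (W3l∕W3m's level range `K ≤ m + K` is automatic).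
* §2 **`EventSide.cutoffReading_towerLaw`** (abstract base state + averagings; W3m's `cutoffRP_towerLaw` +
  `isProbabilityMeasure_towerLaw` BY NAME) and **`EventSide.cutoffReading_towerLaw_gibbs_SU`** (the `SU(n)` Wilson–Gibbs
  tower of the tree's typing `blockAvg ℰ` of the printed averaging (0.4): W3m's `cutoffRP_towerLaw_gibbs_SU` + W3h's
  `isProbabilityMeasure_gibbsMeasure` BY NAME — `prob` and the RP half hypothesis-free up to `0 ≤ β`, `K ≤ m + K` and
  measurable small-loop averages): W4b′'s full 21-clause `CutoffReading` on `Tower P G K` FROM ITS EVENT HALF ALONE; and the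
  END **`hybridNE7_of_towerEventSides_SU`**: two families (runs A, B; couplings `β K ≥ 0`, averagings `ℰ K k`) of EVENT
  HALVES on the Gibbs towers over `cutoffParams P₀ K` ⇒ `HybridNE7` with weight `e^{2·ob·l₀}·#P·N^d·(r + r′)`,
  `N := 2·P₀.L^P₀.m` — NO `Even`, NO RP, NO `prob` hypothesis left (file 4a's `hybridNE7_of_cutoffReadingsN` with
  `hN := sitesPerDir_cutoffParams_self`).
* §3 sanity: the event half is INHABITED on the ACTUAL carrier `Tower P SU(n) K` with the ACTUAL Gibbs tower law (one term,
  trivial events; `eventSide_trivial`), hence W4b′'s 21-clause reading is inhabited IN SITU (`example`, via §2).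

LOCATED LIMITATION (the reason for file 4c `HistoryChessboardEventsCubes`).  Here the block torus is indexed by the
SITES of the unit lattice (`N = 2·L^m`): a cell is a unit cube, so a cell event can read every level `< K` of the tower
under that cube but NO bond of the top field `Ū^K` (a unit-lattice bond joins two cells and belongs to neither half of a
between-sites cut); cells the cubes of side `L^{m₁}` (`N = 2·L^{m−m₁}`, reflections in the cube boundaries only) are file
4c.

HONEST SCOPE (R-OWNER-23-8 wording for road W-RP).  What stays DISPLAYED for an instantiating seat of the tower-law
reading is exactly file 4a's `EventSide`: (EXT) — the event model of Bałaban's terms (`repr`, `ev_cover`, `bad_disj`,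
`bad_sub` + measurability bookkeeping); (LOC)∕(R-sym) for the CHOSEN cell events (`loc`, `sym` relative to `cutPos`∕`cutRefl`;
for column events their producers are W3m file 2 `HistoryRPTowerCells`, leaf-04 g6 — not imported, not restated);
(U1)+(G2) in ratio currency (`univ_le`).  The typing identification «`blockAvg ℰ` is Bałaban's (0.4)» is T-class; the
identification «the run's extended state at cutoff `K` IS `towerLaw (gibbsMeasure (cutoffParams P₀ K) β_K) (blockAvg ℰ_K) K`»
is the cell's own definition of its torus scheme, not a reading of print.  Nothing of H3 ∕ (B) ∕ BetaPertH is discharged;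
the count 0∕9 is unchanged.  NE7b NOT proved; spine 0∕9.  HONEST DEPENDENCY (cell): continuum YM on T⁴ ⇐ BetaPertH ∧ nine
spine estimates (0/9 proved); BetaPertH ⇐ (D1) ∧ (D4) ∧ CAP+tail; G-an2-4 gates asym, D1 and NE2/3/4.  This file changes
none of it.
-/

open Finset MeasureTheory Literature.Barriers.CriticalPhenomena.NonGibbs Literature.Probability.LatticeModels
open Literature.MathematicalPhysics.QuantumFieldTheory.Balaban1983to89
open T4IndicatorShell T4MatchingAssembly T4MatchingClosure
open Literature.MathematicalPhysics.QuantumFieldTheory.LatticeRP (IsReflectionPositiveBdd)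
open Summit.QuantumFields.BalabanUV.T4Continuum HistoryChessboardAssembly HistoryChessboardEvents
open HistoryChessboardEventsCutoff HistoryChessboardEventsSplit HistoryRPTowerLaw HistoryRPTowerCuts BlockAveraging
open T4ReflectionConeSharp
open Summit.QuantumFields.BalabanUV.T4Continuum.HistoryRPHalfTorus (mPos)

namespace Summit.QuantumFields.BalabanUV.T4Continuum.HistoryChessboardEventsTower

noncomputable section

/-! ## §1 The fixed-physical-volume cutoff family; (EVEN) is a theorem -/

section Tower

/-- **THE FIXED-PHYSICAL-VOLUME CUTOFF FAMILY**: dimension `d`, block size `L`, volume exponent `m` of `P₀`; number of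
RG steps `K :=` the cutoff (`ε = L^{−K}`).  Its unit lattice (level `K`) has `2·L^m` sites per direction at every cutoff. -/
abbrev cutoffParams (P₀ : Params) (K : ℕ) : Params := { P₀ with K := K }

/-- the site counts of the cutoff family. [folklore] -/
theorem sitesPerDir_cutoffParams (P₀ : Params) (K j : ℕ) :
    (cutoffParams P₀ K).sitesPerDir j = 2 * P₀.L ^ (P₀.m + K - j) := rfl

/-- **THE UNIT LATTICE OF EVERY CUTOFF HAS `2·L^m` SITES PER DIRECTION.** [folklore] -/
theorem sitesPerDir_cutoffParams_self (P₀ : Params) (K : ℕ) : (cutoffParams P₀ K).sitesPerDir K = 2 * P₀.L ^ P₀.m := by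
  rw [sitesPerDir_cutoffParams, Nat.add_sub_cancel]

/-- **(EVEN) IS A THEOREM**: the block count of the unit lattice is even (Bałaban's tori have `2·L^j` sites per direction,
`Setup.sitesPerDir`) — W4's format hypothesis `Even N` needs no display for this family. [folklore] -/
theorem even_sitesPerDir (P : Params) (j : ℕ) : Even (P.sitesPerDir j) := even_two_mul _

/-- `2·L^m` is even. [folklore] -/
theorem even_two_mul_pow (P₀ : Params) : Even (2 * P₀.L ^ P₀.m) := even_two_mul _

/-- `2·L^m ≠ 0` (the `NeZero` instance `ZMod`∕`BlockIdx` need at the common block count). [folklore] -/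
instance neZero_two_mul_pow (P₀ : Params) : NeZero (2 * P₀.L ^ P₀.m) :=
  ⟨mul_ne_zero two_ne_zero (pow_ne_zero _ P₀.L_pos.ne')⟩

/-- `K ≤ m + K` for the cutoff family at its own cutoff (the range hypothesis of W3l∕W3m is automatic). [folklore] -/
theorem le_m_add_K_cutoffParams (P₀ : Params) (K : ℕ) : K ≤ (cutoffParams P₀ K).m + (cutoffParams P₀ K).K :=
  Nat.le_add_left K P₀.m

/-! ## §2 W4b′'s reading for the tower law from its event half alone; the END over the Gibbs towers -/

variable {P : Params} {G : Type*} [GaugeGroup G] [MeasurableSpace G] {ι Λ : Type*} {Pat : Finset Λ} {T : Finset ι}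
  {A : ℝ → ι → ℝ} {Bad : Finset ι} {Z : ℝ} {K : ℕ} {ev : ι → Set (Tower P G K)} {obs : Tower P G K → ℝ} {ob : ℝ}
  {E : Λ → BlockIdx P.d (P.sitesPerDir K) → Set (Tower P G K)} {r : ℝ}

/-- **W4b′'s READING FOR THE TOWER LAW FROM ITS EVENT HALF ALONE** (abstract base state and averagings): on the carrier
`Tower P G K` with the state `towerLaw μ av K`, positive algebras `cutPos G K` and reflections `cutRefl K`, the event half
+ the two base binders at level `0` (centre-reflection invariance and reflection positivity of `μ`), base translation
invariance and measurable ∕ two-block-local ∕ centre-equivariant ∕ block-translation-covariant averagings give the full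
21-clause `CutoffReading` — `prob` by W3m's `isProbabilityMeasure_towerLaw`, the RP half by W3m's `cutoffRP_towerLaw`
BY NAME. [folklore] -/
theorem _root_.Summit.QuantumFields.BalabanUV.T4Continuum.HistoryChessboardEventsSplit.EventSide.cutoffReading_towerLaw
    [MeasurableInv G] {av : (k : ℕ) → Averaging P k G}
    (hA : ∀ k, Measurable (av k).avg) (hL : ∀ k, TwoBlockLocal (av k))
    (hR : ∀ (ρ : Fin P.d) k (U : GaugeField P k G), (av k).avg (U.creflect ρ) = ((av k).avg U).creflect ρ)
    (hAT : ∀ (k : ℕ) (a : Site P (k + 1)) (U : GaugeField P k G),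
      (av k).avg (U.translate (Site.scale a)) = ((av k).avg U).translate a)
    {μ : Measure (GaugeField P 0 G)} [IsProbabilityMeasure μ]
    (hθ : ∀ ρ : Fin P.d, MeasurePreserving (GaugeField.creflect ρ) μ μ)
    (hRP : ∀ ρ : Fin P.d, IsReflectionPositiveBdd μ (mPos G 0 ρ) (GaugeField.creflect ρ))
    (hT : ∀ a₀ : Site P 0, MeasurePreserving (GaugeField.translate a₀) μ μ) (hK : K ≤ P.m + P.K)
    (H : EventSide P.d (P.sitesPerDir K) Pat T A Bad (towerLaw μ av K) Z ev obs ob E (cutRefl K) (cutPos G K) r) :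
    CutoffReading P.d (P.sitesPerDir K) Pat T A Bad (towerLaw μ av K) Z ev obs ob E (cutRefl K) (cutPos G K) r :=
  H.cutoffReading (isProbabilityMeasure_towerLaw hA μ K) (cutoffRP_towerLaw hA hL hR hAT hθ hRP hT K hK)

/-- **… FOR THE TOWER OF BAŁABAN'S BLOCK AVERAGINGS (0.4) OVER ANY BASE STATE WITH THE LEVEL-0 PACKAGE** (tree
`blockAvg (ℰ k)`, any compact gauge group with measurable inversion; the two base binders, base translation invariance):
W3m's `cutoffRP_towerLaw_blockAvg` BY NAME. [folklore] -/
theorem _root_.Summit.QuantumFields.BalabanUV.T4Continuum.HistoryChessboardEventsSplit.EventSide.cutoffReading_towerLaw_blockAvg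
    [RegularGaugeGroup G] (ℰ : ℕ → LoopAverage G)
    (hE : ∀ k l, Measurable fun W : Fin (l + 1) → G => (ℰ k).E W)
    {μ : Measure (GaugeField P 0 G)} [IsProbabilityMeasure μ]
    (hθ : ∀ ρ : Fin P.d, MeasurePreserving (GaugeField.creflect ρ) μ μ)
    (hRP : ∀ ρ : Fin P.d, IsReflectionPositiveBdd μ (mPos G 0 ρ) (GaugeField.creflect ρ))
    (hT : ∀ a₀ : Site P 0, MeasurePreserving (GaugeField.translate a₀) μ μ) (hK : K ≤ P.m + P.K)
    (H : EventSide P.d (P.sitesPerDir K) Pat T A Bad (towerLaw μ (fun k => blockAvg (P := P) (j := k) (ℰ k)) K) Z ev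
      obs ob E (cutRefl K) (cutPos G K) r) :
    CutoffReading P.d (P.sitesPerDir K) Pat T A Bad (towerLaw μ (fun k => blockAvg (P := P) (j := k) (ℰ k)) K) Z ev
      obs ob E (cutRefl K) (cutPos G K) r :=
  H.cutoffReading (isProbabilityMeasure_towerLaw (fun k => measurable_avgFun (ℰ k) (hE k)) μ K)
    (cutoffRP_towerLaw_blockAvg ℰ hE hθ hRP hT K hK)

variable {n : ℕ} [NeZero n]

/-- **W4b′'s READING FOR THE `SU(n)` WILSON–GIBBS TOWER OF BAŁABAN'S BLOCK AVERAGINGS (0.4), FROM ITS EVENT HALF ALONE**: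
carrier `Tower P SU(n) K`, state `towerLaw (gibbsMeasure P β) (blockAvg ℰ) K`, `mP := cutPos`, `θ := cutRefl`; the RP half
and `prob` hypothesis-free up to `0 ≤ β`, `K ≤ m + K` and measurable small-loop averages (W3m's
`cutoffRP_towerLaw_gibbs_SU`, W3h's `isProbabilityMeasure_gibbsMeasure` via `isProbabilityMeasure_towerLaw`). [folklore] -/
theorem _root_.Summit.QuantumFields.BalabanUV.T4Continuum.HistoryChessboardEventsSplit.EventSide.cutoffReading_towerLaw_gibbs_SU
    (P : Params) {β : ℝ} (hβ : 0 ≤ β)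
    (ℰ : ℕ → LoopAverage (Matrix.specialUnitaryGroup (Fin n) ℂ))
    (hE : ∀ k l, Measurable fun W : Fin (l + 1) → Matrix.specialUnitaryGroup (Fin n) ℂ => (ℰ k).E W)
    {K : ℕ} (hK : K ≤ P.m + P.K) {ev : ι → Set (Tower P (Matrix.specialUnitaryGroup (Fin n) ℂ) K)}
    {obs : Tower P (Matrix.specialUnitaryGroup (Fin n) ℂ) K → ℝ}
    {E : Λ → BlockIdx P.d (P.sitesPerDir K) → Set (Tower P (Matrix.specialUnitaryGroup (Fin n) ℂ) K)}
    (H : EventSide P.d (P.sitesPerDir K) Pat T A Bad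
      (towerLaw (T4GenFunBounds.gibbsMeasure (G := Matrix.specialUnitaryGroup (Fin n) ℂ) P β)
        (fun k => blockAvg (P := P) (j := k) (ℰ k)) K)
      Z ev obs ob E (cutRefl K) (cutPos (Matrix.specialUnitaryGroup (Fin n) ℂ) K) r) :
    CutoffReading P.d (P.sitesPerDir K) Pat T A Bad
      (towerLaw (T4GenFunBounds.gibbsMeasure (G := Matrix.specialUnitaryGroup (Fin n) ℂ) P β)
        (fun k => blockAvg (P := P) (j := k) (ℰ k)) K)
      Z ev obs ob E (cutRefl K) (cutPos (Matrix.specialUnitaryGroup (Fin n) ℂ) K) r := by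
  haveI := T4GenFunBounds.isProbabilityMeasure_gibbsMeasure (G := Matrix.specialUnitaryGroup (Fin n) ℂ) P hβ
  exact H.cutoffReading
    (isProbabilityMeasure_towerLaw (fun k => measurable_avgFun (ℰ k) (hE k)) _ K)
    (cutoffRP_towerLaw_gibbs_SU P hβ ℰ hE K hK)

variable [DecidableEq ι] {T : ℕ → Finset ι} {K₀ : ℕ} {A B shA shB Cc Rr CcRec RrRec : ℕ → ℝ → ι → ℝ}
  {Bad : ℕ → Finset ι} {Z Z' : ℕ → ℝ} {r r' ν u s₂ c₀ rr s Wsh : ℕ → ℝ} {l₀ vol : ℝ}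

/-- **THE ROAD'S END OVER THE `SU(n)` GIBBS TOWERS OF THE CUTOFF FAMILY** (node U5, seam (ζ′)): run A = the towers
`(U, Ū, …, Ū^K)` over `cutoffParams P₀ K` with couplings `βA K ≥ 0` and block averagings `ℰA K k`, run B likewise; at
every cutoff `K ≥ K₀` ONLY THE EVENT HALVES are hypotheses (relative to `cutPos`∕`cutRefl` of the unit lattice) — `prob`,
the five RP clauses (W3m), the transport to the common block count `N := 2·L^m` (file 4a §2) and `Even N` (§1) are PRODUCED;
with summable rates, the NE7c socket, the NE7 budget and four summable rates: `HybridNE7` with weight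
`e^{2·ob·l₀}·#P·N^d·(r + r′)`.  Nothing PRINTED is asserted; NE7b is NOT proved by this. [folklore] -/
theorem hybridNE7_of_towerEventSides_SU (P₀ : Params) {βA βB : ℕ → ℝ} (hβA : ∀ K, 0 ≤ βA K) (hβB : ∀ K, 0 ≤ βB K)
    (ℰA ℰB : ℕ → ℕ → LoopAverage (Matrix.specialUnitaryGroup (Fin n) ℂ))
    (hEA : ∀ K k l, Measurable fun W : Fin (l + 1) → Matrix.specialUnitaryGroup (Fin n) ℂ => (ℰA K k).E W)
    (hEB : ∀ K k l, Measurable fun W : Fin (l + 1) → Matrix.specialUnitaryGroup (Fin n) ℂ => (ℰB K k).E W)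
    {ev : ∀ K, ι → Set (Tower (cutoffParams P₀ K) (Matrix.specialUnitaryGroup (Fin n) ℂ) K)}
    {obs : ∀ K, Tower (cutoffParams P₀ K) (Matrix.specialUnitaryGroup (Fin n) ℂ) K → ℝ} {ob : ℝ}
    {E : ∀ K, Λ → BlockIdx P₀.d ((cutoffParams P₀ K).sitesPerDir K) →
      Set (Tower (cutoffParams P₀ K) (Matrix.specialUnitaryGroup (Fin n) ℂ) K)}
    {ev' : ∀ K, ι → Set (Tower (cutoffParams P₀ K) (Matrix.specialUnitaryGroup (Fin n) ℂ) K)}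
    {obs' : ∀ K, Tower (cutoffParams P₀ K) (Matrix.specialUnitaryGroup (Fin n) ℂ) K → ℝ}
    {E' : ∀ K, Λ → BlockIdx P₀.d ((cutoffParams P₀ K).sitesPerDir K) →
      Set (Tower (cutoffParams P₀ K) (Matrix.specialUnitaryGroup (Fin n) ℂ) K)}
    (HA : ∀ K, K₀ ≤ K → EventSide P₀.d ((cutoffParams P₀ K).sitesPerDir K) Pat (T K) (A K) (Bad K)
      (towerLaw (T4GenFunBounds.gibbsMeasure (G := Matrix.specialUnitaryGroup (Fin n) ℂ) (cutoffParams P₀ K) (βA K))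
        (fun k => blockAvg (P := cutoffParams P₀ K) (j := k) (ℰA K k)) K)
      (Z K) (ev K) (obs K) ob (E K) (cutRefl (P := cutoffParams P₀ K) K)
      (cutPos (P := cutoffParams P₀ K) (Matrix.specialUnitaryGroup (Fin n) ℂ) K) (r K))
    (HB : ∀ K, K₀ ≤ K → EventSide P₀.d ((cutoffParams P₀ K).sitesPerDir K) Pat (T K) (B K) (Bad K)
      (towerLaw (T4GenFunBounds.gibbsMeasure (G := Matrix.specialUnitaryGroup (Fin n) ℂ) (cutoffParams P₀ K) (βB K))
        (fun k => blockAvg (P := cutoffParams P₀ K) (j := k) (ℰB K k)) K)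
      (Z' K) (ev' K) (obs' K) ob (E' K) (cutRefl (P := cutoffParams P₀ K) K)
      (cutPos (P := cutoffParams P₀ K) (Matrix.specialUnitaryGroup (Fin n) ℂ) K) (r' K))
    (hr : Summable r) (hr' : Summable r')
    (hSh : ShellWeightBound l₀ T A B shA shB Wsh)
    (hTB : ReindexedBudget l₀ vol T (fun K t τ => A K t τ - shA K t τ) (fun K t τ => B K t τ - shB K t τ)
      (fun K _ => Bad K) Cc Rr CcRec RrRec ν u s₂ c₀ rr s)
    (hrr : Summable rr) (hu : Summable u) (hs : Summable s) (hs₂ : Summable s₂) :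
    ∃ K₁ K₂, K₀ ≤ K₁ ∧ HybridNE7 l₀ vol (fun K => T (K₁ + (K₂ + K))) (fun K => A (K₁ + (K₂ + K)))
      (fun K => B (K₁ + (K₂ + K))) (fun K _ => Bad (K₁ + (K₂ + K)))
      (fun K => Real.exp (2 * (ob * l₀)) *
        ((#Pat : ℝ) * ((2 * P₀.L ^ P₀.m : ℕ) : ℝ) ^ P₀.d * (r (K₁ + (K₂ + K)) + r' (K₁ + (K₂ + K)))))
      (fun K => shA (K₁ + (K₂ + K))) (fun K => shB (K₁ + (K₂ + K))) (fun K => Wsh (K₁ + (K₂ + K)))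
      (fun K => (rr (K₁ + (K₂ + K)) + u (K₁ + (K₂ + K))) + (s (K₁ + (K₂ + K)) + s₂ (K₁ + (K₂ + K)))) :=
  hybridNE7_of_cutoffReadingsN (Nf := fun K => (cutoffParams P₀ K).sitesPerDir K)
    (Nf' := fun K => (cutoffParams P₀ K).sitesPerDir K) (even_two_mul_pow P₀)
    (sitesPerDir_cutoffParams_self P₀) (sitesPerDir_cutoffParams_self P₀)
    (fun K hK => (HA K hK).cutoffReading_towerLaw_gibbs_SU (cutoffParams P₀ K) (hβA K) (ℰA K) (hEA K)
      (le_m_add_K_cutoffParams P₀ K))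
    (fun K hK => (HB K hK).cutoffReading_towerLaw_gibbs_SU (cutoffParams P₀ K) (hβB K) (ℰB K) (hEB K)
      (le_m_add_K_cutoffParams P₀ K))
    hr hr' hSh hTB hrr hu hs hs₂

end Tower

/-! ## §3 Sanity: the event half — hence W4b′'s reading — is inhabited IN SITU -/

namespace Sanity

variable {n : ℕ} [NeZero n]

/-- NON-VACUITY IN SITU: on the ACTUAL carrier `Tower P SU(n) K` with the ACTUAL Gibbs tower law of Bałaban's block
averagings, the event half is INHABITED by the trivial term family (one term with event `univ` and weight `Z = 1`, empty
bad class, all cell events `univ`, source `0`, rate `1`) — relative to W3m's `cutPos`∕`cutRefl`. [folklore] -/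
theorem eventSide_trivial (P : Params) {β : ℝ} (hβ : 0 ≤ β)
    (ℰ : ℕ → LoopAverage (Matrix.specialUnitaryGroup (Fin n) ℂ))
    (hE : ∀ k l, Measurable fun W : Fin (l + 1) → Matrix.specialUnitaryGroup (Fin n) ℂ => (ℰ k).E W) (K : ℕ) :
    EventSide P.d (P.sitesPerDir K) ({()} : Finset Unit) ({()} : Finset Unit) (fun _ _ => (1 : ℝ)) (∅ : Finset Unit)
      (towerLaw (T4GenFunBounds.gibbsMeasure (G := Matrix.specialUnitaryGroup (Fin n) ℂ) P β)
        (fun k => blockAvg (P := P) (j := k) (ℰ k)) K)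
      1 (fun _ => Set.univ) (fun _ => 0) 0 (fun _ _ => Set.univ) (cutRefl K)
      (cutPos (Matrix.specialUnitaryGroup (Fin n) ℂ) K) 1 := by
  haveI := T4GenFunBounds.isProbabilityMeasure_gibbsMeasure (G := Matrix.specialUnitaryGroup (Fin n) ℂ) P hβ
  haveI := isProbabilityMeasure_towerLaw (P := P) (av := fun k => blockAvg (P := P) (j := k) (ℰ k))
    (fun k => measurable_avgFun (ℰ k) (hE k))
    (T4GenFunBounds.gibbsMeasure (G := Matrix.specialUnitaryGroup (Fin n) ℂ) P β) K
  exact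
  { Z_pos := one_pos
    bad_subset := Finset.empty_subset _
    ev_meas := fun _ _ => MeasurableSet.univ
    E_meas := fun _ _ _ => MeasurableSet.univ
    obs_meas := measurable_const
    obs_bdd := fun _ => by simp
    ob_nonneg := le_rfl
    repr := fun t τ _ => by simp [Measure.restrict_univ]
    ev_cover := fun ω _ => Set.mem_iUnion₂.2 ⟨(), Finset.mem_singleton_self _, Set.mem_univ ω⟩
    bad_disj := by simp
    bad_sub := by simp
    loc := fun _ _ _ _ _ _ => MeasurableSet.univ
    sym := fun _ _ _ _ _ => by simp
    univ_le := fun _ _ => (measureReal_mono (Set.subset_univ _) (measure_ne_top _ _)).trans_eq (by simp)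
    r_nonneg := zero_le_one }

/-- … hence W4b′'s full 21-clause `CutoffReading` is INHABITED on Bałaban's carrier with the cell's own state, the RP
half coming from W3m (`K ≤ m + K`). -/
example (P : Params) {β : ℝ} (hβ : 0 ≤ β) (ℰ : ℕ → LoopAverage (Matrix.specialUnitaryGroup (Fin n) ℂ))
    (hE : ∀ k l, Measurable fun W : Fin (l + 1) → Matrix.specialUnitaryGroup (Fin n) ℂ => (ℰ k).E W) (K : ℕ)
    (hK : K ≤ P.m + P.K) :
    CutoffReading P.d (P.sitesPerDir K) ({()} : Finset Unit) ({()} : Finset Unit) (fun _ _ => (1 : ℝ))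
      (∅ : Finset Unit)
      (towerLaw (T4GenFunBounds.gibbsMeasure (G := Matrix.specialUnitaryGroup (Fin n) ℂ) P β)
        (fun k => blockAvg (P := P) (j := k) (ℰ k)) K)
      1 (fun _ => Set.univ) (fun _ => 0) 0 (fun _ _ => Set.univ) (cutRefl K)
      (cutPos (Matrix.specialUnitaryGroup (Fin n) ℂ) K) 1 :=
  (eventSide_trivial P hβ ℰ hE K).cutoffReading_towerLaw_gibbs_SU P hβ ℰ hE hK

end Sanity

end

end Summit.QuantumFields.BalabanUV.T4Continuum.HistoryChessboardEventsTower
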